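import Literature.MathematicalPhysics.QuantumFieldTheory.Balaban1983to89.Node00.CarriersYU
import Literature.MathematicalPhysics.QuantumFieldTheory.Balaban1983to89.B9SectBStepUOfMembersR
import Literature.MathematicalPhysics.QuantumFieldTheory.Balaban1983to89.B9PinCarriersKLevelV1R
import Literature.MathematicalPhysics.QuantumFieldTheory.Balaban1983to89.B9LeafKnitOn

/-!
# `Balaban1983to89.B9LeafXCodedKnitU` — THE [B9] LEAF `B9LeafX` OVER THE CODED CARRIER (`Node00.carriersYU`), KNIT FIELDWISE FROM
# THE CODED SECT.-B STEP IN U-LETTERS, THE RECORD's `U ≡ 1` BLOCK AND THE RECORD's CLASS-PREMISED ROWS (pub-ymgap N06, FLAG №8, SOCKET road (α), piece (α3))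

T. Bałaban, *Propagators for lattice gauge theories in a background field*, Commun. Math. Phys. **99** (1985) 389–434
[`Balaban1985BackgroundPropagators`, "B9"], Sect. 3: Thms 3.1–3.4 and Cors 3.5–3.6 pp. 397–408 (Sect. B pp. 400–407; p. 407 *«Thus Theorem 3.4 is
proved, assuming that Theorems 3.1–3.3 hold»*; p. 410 *«Theorem 3.7 implies that all the inequalities (3.42)–(3.47) hold for G′»*), Thms 3.7–3.15,
Cor. 3.8, (3.49), (3.132) pp. 409–432; the class (3.35)–(3.38) p. 396; [4] = T. Bałaban, *Propagators and renormalization transformations for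
lattice gauge theories. II*, Commun. Math. Phys. **96** (1984) 223–250 [`Balaban1984PropagatorsII`], Props. 2.2, 2.3, 2.6 (the case `U = 1`).

statement-level bookkeeping over published theorems with citation tags; proofs where landed; nothing here is a claim about the Yang–Mills mass gap

WHY THIS FILE (cell context).  The N06 certificate of record (`Summits/…/BalabanUVNodesN06AtOpsYNuOfRecordV6EPairSB`, edition 75) concludes
`B9LeafX (Y9OfRecordP …)` through `B9PinCarriersKLevelV1R.b9LeafX_carriersYR`, DISPLAYING the Sect.-B step `hB : B9.SectBStepPrinted … (ops x).Gp
(ops x).GA …` in W-LETTERS over `bg9YR` — LOCATED unsatisfiable-as-instantiated at `M_N(ℂ)`, `N ≥ 2` (dag-n06-c LOCATED-11; node00-def-Y R13-U1;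
director-ym №215 ∕ №282 (B) ∕ №290 (1)(c)).  The cure of record is SOCKET road (α): (α1) `B9SectBCodedCarrierPullbacks` (the record's carriers read
along a decoding + the RECORD ⇒ CODING transfers of the base-only printed statements), (α2) `Node00.CarriersYU` (the carrier bundle `carriersYU P G f b
ιB C38 ops` over dag-n06-c's coded carrier, `G′ ∕ G` in U-LETTERS `KSCU ∕ KACU`), (α3) = THIS FILE + the re-leafed certificate: the leaf `B9LeafX
(carriersYU …)` assembled from the CODED Sect.-B step `B9SectBCodedReadingsUR.SectBStepU P f …` — the conclusion of dag-n06-c's GUARDED object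
`B9SectBStepUGuardedR.sectBStepU_C37GY_unitary_extraYPb_d261Y` — in place of `hB`.

HOW (the knit is FIELDWISE, not through `B9LeafKnit.b9LeafX_of_leaves`): the Sect.-C summation leaf `B9.RWSumsYieldIneqs` over the coded carrier
for `KSCU` would ask the record's sums at a product code `U′U` to bound the U-letter reading at the base `U` — not a statement of the paper; it is
neither used nor displayed here.  Instead: Thms 3.1 ∕ 3.2 ∕ 3.3 are derived AT THE RECORD (`B9.thm31_of_thm37`, `thm32_of_thm39`,
`thm33_of_thm37_310` over the full member family at the classes `(regC335 P, regC336 P)`), restricted to the subfamily (§0), re-keyed to NODE 00's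
letter readings by three displayed PINS (`hGpPin ∕ hGAPin ∕ hCinvPin`: at the members `f j` the record's `G′, G, C⁻¹` ARE `kernelFamilyS … (GpY parSymY)
parSymY`, `kernelFamilyB … (GAY …) parBY`, `CinvY P … parSymY` — `rfl` at the record of Stage 3′(Y)), and moved to the coded carrier (§1:
(3.35)-regular coded configurations are bases, where `KSCU ∕ KACU` ARE the record's readings — dag-n06-c `KSCU_members_base`, `thms_KSCU_base_iff`);
the `U ≡ 1` block comes from the node's [B6] in-edge exactly as in `b9LeafX_carriersYR` (`B9LeafKnitOn.baseU1_of_b6BlockParam_on` at the record,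
then §0 ∕ §1); Cor. 3.5 by `B9.cor35_of_sectB_base`, Cor. 3.6 VACUOUS (`B9PinGeometryKLevelV1.not_inCubeY`), Thm 3.4 by `B9.thm34_of_sectB`; the
eleven class-premised rows (3.7, 3.8, 3.9, 3.10, 3.11, 3.12, 3.13, 3.14, 3.14-local, 3.15, (3.49), (3.132)) are taken AT THE RECORD in the
certificate's shapes and moved by §0 + (α1)'s `*_coded`.

WHAT IS IN THE FILE (0 `def`, 0 `sorry`; standard axioms).
* §0 `thm37Printed_reindex` … `thm314LocalPrinted_reindex`, `baseU1Printed_reindex`, `thm31∕32∕33Printed_reindex` — the printed statements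
  («∃ constants, ∀ member …») restrict along any re-indexing `φ : J → I` of the family (p. 399: the family is a parameter).
* §1 `thm31Printed_codedU` (twin of dag-n06-c's `thm33Printed_codedU` for Thm 3.1), `baseU1Printed_codedU` (the `U ≡ 1` block).
* §2 ★★★ `b9LeafX_carriersYU` — `B9LeafX (carriersYU P G f b ιB C38 ops)` from: the class law of `U ≡ 1` at the members (`hone`), the eight
  `U = 1` comparisons + two null readings + the residual entries (VERBATIM `b9LeafX_carriersYR`'s), the three pins, ★ the coded step AS A FUNCTION of the record's Thms 3.2 ∕ 3.3 on the subfamily `hB : Thm32Printed … →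
  Thm33Printed … → SectBStepU P f (d+1) c35Y G b parSymY (GAY …) parBY (C37GY · (cqY d)) C38 (CinvY P f G parSymY)` (dag-n06-c's §4b shape), the record's rows 15–26 at `(regC335 P,
  regC336 P)` (VERBATIM `b9LeafX_carriersYR`'s shapes), the [B6] block.  Generic in the class parameter `P`, the operator layer `ops`, the
  subfamily `f`, the sections `ιB`, the (3.38) classes `C38`, the fibre basis `b`.

HONEST SCOPE.  Composition of landed theorems and quantifier bookkeeping; nothing of [B9] is asserted or proved here beyond what the inputs say;
the coded step, the pins, the rows, the dictionary and the [B6] block stay DISPLAYED hypotheses of §2.  COUNT-NEUTRAL; N06 NOT discharged; FLAG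
№8 is closed only by the certificate edition that CALLS §2 on dag-n06-c's guarded step; one finite lattice programme at fixed `ε` — nothing
continuum ∕ OS ∕ mass-gap ∕ Clay.  Cell `pub-ymgap` (HUMAN RULING D-0062), Track A node N06 [B9], seat `pub-ymgap-dag-n06-d` (g19), 2026-08-29.

RELATED IN THE TREE, NOT DUPLICATED: `Node00.CarriersYU` (the bundle, its `rfl` faces), `B9SectBCodedCarrierPullbacks` (the fourteen `*_coded`),
`B9SectBStepUOfMembersR` (`thm32∕33Printed_codedU`), `B9SectBCodedChainR3` (`B9SectBStepsKSCUR.KSCU_members_base ∕ thms_KSCU_base_iff ∕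
ineq342_346_347_congr`, `B9SectBGpTransferInYR.ineq343_345_congr`), `B9PinCarriersKLevelV1R` (`carriersYR`, `b9LeafX_carriersYR` — the W-letter
sibling), `B9LeafKnitOn.baseU1_of_b6BlockParam_on`, `B9` (the architecture lemmas) — all USED BY NAME.
-/

noncomputable section

namespace Literature.MathematicalPhysics.QuantumFieldTheory.Balaban1983to89.B9LeafXCodedKnitU

open DagBinding (PrintedCarriers9X B9LeafX B6BlockParam)
open B9PinMembersKLevelV1 (MemberY geo9Y bg9Y)
open B9BackgroundsKLevelV1R (RegFamY bg9YR kernelFamilyR kernelFamilyRY siteKernelR fineKernelR rwExpansionR rwKernelExpansionR hKernelR hKernelRY)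
open B9PinGeometryKLevelV1 (dOmegaY OmKY inΛY unitDistY InCubeY c35Y c35Y_pos dictAtOneY not_inCubeY)
open B9PinCarriersKLevelV1 (OperatorLayerY)
open B9PinCarriersKLevelV1R (carriersYR)
open B9SectBCodedClassR (RegExtraY regC335 regC336 bg9YC)
open B9SectBCodedCarrier (Coding pullK pullS)
open B9SectBCodedCarrierPullbacks (pullF pullH pullRW pullRWK pullC pullPK pullPH pullPK₀ thm31Printed_coded thm37Printed_coded cor38Printed_coded thm39Printed_coded
  thm310Printed_coded thm311Printed_coded thm312Printed_coded thm313Printed_coded thm314Printed_coded thm314LocalPrinted_coded thm315FullPrinted_coded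
  stmt349Printed_coded stmt3132Printed_coded)
open B9SectBGpFrameCodedYR (codingYx)
open B9SectBCodedReadingsUR (KSCU KACU SectBStepU)
open B9SectBCodedChainAnR (IsAnKY)
open B9SectBKerFrameCodedYR (CinvY)
open B9SectBCodedClassGY (C37GY)
open B9SectBStepsKSCUR (KSCU_members_base KACU_members_base ineq342_346_347_congr thms_KSCU_base_iff)
open B9SectBGpTransferInYR (ineq343_345_congr)
open B9SectBStepUOfMembersR (thm32Printed_codedU thm33Printed_codedU)
open B9LeafKnitOn (baseU1_of_b6BlockParam_on)
open B9Eq360DeltaPrimeAY (AfldY)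
open B6Ineq2142KLevelV1 (β)
open Node00 (SiteY BlkY IBondY CfgY SiteParY BondParY BondOpY GAY GpY parSymY parBY kernelFamilyS kernelFamilyB carriersYU codingYU cqY)

/-! ## §0 The printed statements restrict along a re-indexing of the family -/

section Reindex

open B9

variable {I J : Type} (φ : J → I) (d : ℕ) (c35 : ℝ) (geo : I → Geometry) (bg : I → Backgrounds)

/-- Theorem 3.7 as typed restricts along a re-indexing of the family. [cite: Balaban1985BackgroundPropagators, Thm 3.7 p.409, p.399 (the family as a parameter)] -/
theorem thm37Printed_reindex (E : ∀ i, RWExpansion (geo i) (bg i)) (h : Thm37Printed c35 geo bg E) :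
    Thm37Printed c35 (fun j => geo (φ j)) (fun j => bg (φ j)) (fun j => E (φ j)) := by
  obtain ⟨M₂, a₀, hM₂, ha₀, H⟩ := h
  exact ⟨M₂, a₀, hM₂, ha₀, fun j => H (φ j)⟩

/-- Corollary 3.8 as typed restricts along a re-indexing. [cite: Balaban1985BackgroundPropagators, Cor. 3.8 (3.94) p.410] -/
theorem cor38Printed_reindex (E : ∀ i, RWExpansion (geo i) (bg i)) (h : Cor38Printed c35 geo bg E) :
    Cor38Printed c35 (fun j => geo (φ j)) (fun j => bg (φ j)) (fun j => E (φ j)) := by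
  obtain ⟨M₂, a₀, δ₀, C, c, hM₂, ha₀, hδ₀, hC, hc, H⟩ := h
  exact ⟨M₂, a₀, δ₀, C, c, hM₂, ha₀, hδ₀, hC, hc, fun j => H (φ j)⟩

/-- Theorem 3.9 as typed restricts along a re-indexing. [cite: Balaban1985BackgroundPropagators, Thm 3.9 (3.99) p.412] -/
theorem thm39Printed_reindex (E : ∀ i, RWKernelExpansion (geo i) (bg i)) (h : Thm39Printed d c35 geo bg E) :
    Thm39Printed d c35 (fun j => geo (φ j)) (fun j => bg (φ j)) (fun j => E (φ j)) := by
  obtain ⟨M₂, a₀, δ₀, C, c, hM₂, ha₀, hδ₀, hC, hc, H⟩ := h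
  exact ⟨M₂, a₀, δ₀, C, c, hM₂, ha₀, hδ₀, hC, hc, fun j => H (φ j)⟩

/-- Theorem 3.10 as typed restricts along a re-indexing. [cite: Balaban1985BackgroundPropagators, Thm 3.10 (3.107) p.415] -/
theorem thm310Printed_reindex (E : ∀ i, RWExpansion (geo i) (bg i)) (h : Thm310Printed c35 geo bg E) :
    Thm310Printed c35 (fun j => geo (φ j)) (fun j => bg (φ j)) (fun j => E (φ j)) := by
  obtain ⟨M₂, a₀, δ₀, C, c, hM₂, ha₀, hδ₀, hC, hc, H⟩ := h
  exact ⟨M₂, a₀, δ₀, C, c, hM₂, ha₀, hδ₀, hC, hc, fun j => H (φ j)⟩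

/-- Theorem 3.11 as typed restricts along a re-indexing. [cite: Balaban1985BackgroundPropagators, Thm 3.11 p.416] -/
theorem thm311Printed_reindex (PosDef : ∀ i, Fin 5 → (bg i).Cfg → Prop) (h : Thm311Printed c35 geo bg PosDef) :
    Thm311Printed c35 (fun j => geo (φ j)) (fun j => bg (φ j)) (fun j => PosDef (φ j)) := by
  obtain ⟨M₃, a₀, hM₃, ha₀, H⟩ := h
  exact ⟨M₃, a₀, hM₃, ha₀, fun j => H (φ j)⟩

/-- Theorem 3.12 as typed restricts along a re-indexing. [cite: Balaban1985BackgroundPropagators, Thm 3.12 (3.130)–(3.133) pp.421–422] -/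
theorem thm312Printed_reindex (GD G₁ : ∀ i, KernelFamily (geo i) (bg i)) (H H₁ : ∀ i, HKernel (geo i) (bg i))
    (HasRWExp : ∀ i, KernelFamily (geo i) (bg i) → (bg i).Cfg → ℝ → Prop) (HasRWExpH : ∀ i, HKernel (geo i) (bg i) → (bg i).Cfg → ℝ → Prop)
    (PosDefK : ∀ i, KernelFamily (geo i) (bg i) → (bg i).Cfg → Prop) (h : Thm312Printed d c35 geo bg GD G₁ H H₁ HasRWExp HasRWExpH PosDefK) :
    Thm312Printed d c35 (fun j => geo (φ j)) (fun j => bg (φ j)) (fun j => GD (φ j)) (fun j => G₁ (φ j)) (fun j => H (φ j)) (fun j => H₁ (φ j))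
      (fun j => HasRWExp (φ j)) (fun j => HasRWExpH (φ j)) (fun j => PosDefK (φ j)) := by
  obtain ⟨M₄, δ₀, a₀, B₀, Bβ, Bε, Bεβ, hM₄, hδ₀, ha₀, hB₀, Hm⟩ := h
  exact ⟨M₄, δ₀, a₀, B₀, Bβ, Bε, Bεβ, hM₄, hδ₀, ha₀, hB₀, fun j => Hm (φ j)⟩

/-- Theorem 3.13 as typed restricts along a re-indexing. [cite: Balaban1985BackgroundPropagators, Thm 3.13 (3.154) p.426] -/
theorem thm313Printed_reindex (GG : ∀ i, KernelFamily (geo i) (bg i)) (HasRWExp : ∀ i, KernelFamily (geo i) (bg i) → (bg i).Cfg → ℝ → Prop)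
    (PosDefK : ∀ i, KernelFamily (geo i) (bg i) → (bg i).Cfg → Prop) (h : Thm313Printed c35 geo bg GG HasRWExp PosDefK) :
    Thm313Printed c35 (fun j => geo (φ j)) (fun j => bg (φ j)) (fun j => GG (φ j)) (fun j => HasRWExp (φ j)) (fun j => PosDefK (φ j)) := by
  obtain ⟨M₄, δ₀, a₀, B₀, Bβ, Bε, Bεβ, hM₄, hδ₀, ha₀, hB₀, Hm⟩ := h
  exact ⟨M₄, δ₀, a₀, B₀, Bβ, Bε, Bεβ, hM₄, hδ₀, ha₀, hB₀, fun j => Hm (φ j)⟩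

/-- Theorem 3.14 (sup entries) as typed restricts along a re-indexing. [cite: Balaban1985BackgroundPropagators, Thm 3.14 pp.426–427] -/
theorem thm314Printed_reindex (Kdiff : ∀ i, KernelFamily (geo i) (bg i)) (dOmega : ∀ i, (geo i).Site → (geo i).Site → ℝ)
    (h : Thm314Printed c35 geo bg Kdiff dOmega) :
    Thm314Printed c35 (fun j => geo (φ j)) (fun j => bg (φ j)) (fun j => Kdiff (φ j)) (fun j => dOmega (φ j)) := by
  obtain ⟨M₅, δ₀, a₀, B₀, hM₅, hδ₀, ha₀, hB₀, H⟩ := h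
  exact ⟨M₅, δ₀, a₀, B₀, hM₅, hδ₀, ha₀, hB₀, fun j => H (φ j)⟩

/-- Theorem 3.14 (local reading) as typed restricts along a re-indexing. [cite: Balaban1985BackgroundPropagators, Thm 3.14 pp.426–427] -/
theorem thm314LocalPrinted_reindex (Kdiff : ∀ i, KernelFamily (geo i) (bg i)) (OmK : ∀ i, (geo i).Site → Prop)
    (dOmega : ∀ i, (geo i).Site → (geo i).Site → ℝ) (h : B9Thm314.Thm314LocalPrinted c35 geo bg Kdiff OmK dOmega) :
    B9Thm314.Thm314LocalPrinted c35 (fun j => geo (φ j)) (fun j => bg (φ j)) (fun j => Kdiff (φ j)) (fun j => OmK (φ j)) (fun j => dOmega (φ j)) := by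
  obtain ⟨M₅, δ₀, a₀, B₀, Bβ, Bε, Bεβ, hM₅, hδ₀, ha₀, hB₀, H⟩ := h
  exact ⟨M₅, δ₀, a₀, B₀, Bβ, Bε, Bεβ, hM₅, hδ₀, ha₀, hB₀, fun j => H (φ j)⟩

/-- Theorem 3.15 (full) as typed restricts along a re-indexing. [cite: Balaban1985BackgroundPropagators, Thm 3.15 (3.185)–(3.187) p.432] -/
theorem thm315FullPrinted_reindex (Ck : ∀ i, SiteKernel (geo i) (bg i)) (inΛ : ∀ i, (geo i).Site → Prop)
    (unitDist : ∀ i, (geo i).Site → (geo i).Site → ℝ) (GivenBy3185 : ∀ i, (bg i).Cfg → Prop) (HasRWExpC : ∀ i, (bg i).Cfg → ℝ → Prop)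
    (h : Thm315FullPrinted c35 geo bg Ck inΛ unitDist GivenBy3185 HasRWExpC) :
    Thm315FullPrinted c35 (fun j => geo (φ j)) (fun j => bg (φ j)) (fun j => Ck (φ j)) (fun j => inΛ (φ j)) (fun j => unitDist (φ j))
      (fun j => GivenBy3185 (φ j)) (fun j => HasRWExpC (φ j)) := by
  obtain ⟨δ₀, a₀, B₀, hδ₀, ha₀, hB₀, H⟩ := h
  exact ⟨δ₀, a₀, B₀, hδ₀, ha₀, hB₀, fun j => H (φ j)⟩

/-- (3.49) as typed restricts along a re-indexing. [cite: Balaban1985BackgroundPropagators, (3.49) p.399] -/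
theorem stmt349Printed_reindex (P : ∀ i, FineKernel (geo i) (bg i)) (h : Stmt349Printed d c35 geo bg P) :
    Stmt349Printed d c35 (fun j => geo (φ j)) (fun j => bg (φ j)) (fun j => P (φ j)) := by
  obtain ⟨M₁, δ₀, a₀, C, hM₁, hδ₀, ha₀, hC, H⟩ := h
  exact ⟨M₁, δ₀, a₀, C, hM₁, hδ₀, ha₀, hC, fun j => H (φ j)⟩

/-- (3.132) as typed restricts along a re-indexing. [cite: Balaban1985BackgroundPropagators, (3.132) p.422] -/
theorem stmt3132Printed_reindex (Q Q₁ : ∀ i, SiteKernel (geo i) (bg i)) (h : Stmt3132Printed d c35 geo bg Q Q₁) :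
    Stmt3132Printed d c35 (fun j => geo (φ j)) (fun j => bg (φ j)) (fun j => Q (φ j)) (fun j => Q₁ (φ j)) := by
  obtain ⟨M₄, δ₁, a₀, C, hM₄, hδ₁, ha₀, hC, H⟩ := h
  exact ⟨M₄, δ₁, a₀, C, hM₄, hδ₁, ha₀, hC, fun j => H (φ j)⟩

/-- the `U = 1` block (Thms 3.1–3.3 at `U ≡ 1`, [4]) restricts along a re-indexing. [cite: Balaban1985BackgroundPropagators, Cor. 3.5 proof p.407; Balaban1984PropagatorsII, Props. 2.2–2.6] -/
theorem baseU1Printed_reindex (Gp GA : ∀ i, KernelFamily (geo i) (bg i)) (Cinv : ∀ i, SiteKernel (geo i) (bg i))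
    (h : BaseU1Printed d geo bg Gp GA Cinv) :
    BaseU1Printed d (fun j => geo (φ j)) (fun j => bg (φ j)) (fun j => Gp (φ j)) (fun j => GA (φ j)) (fun j => Cinv (φ j)) := by
  obtain ⟨M₁, B₀, δ₀, Bβ, Bε, Bεβ, B₁, δ₁, hM₁, hB₀, hδ₀, hB₁, hδ₁, H⟩ := h
  exact ⟨M₁, B₀, δ₀, Bβ, Bε, Bεβ, B₁, δ₁, hM₁, hB₀, hδ₀, hB₁, hδ₁, fun j => H (φ j)⟩

/-- Theorem 3.1 as typed restricts along a re-indexing. [cite: Balaban1985BackgroundPropagators, Thm 3.1 (3.42)–(3.47) pp.397–398] -/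
theorem thm31Printed_reindex (Gp : ∀ i, KernelFamily (geo i) (bg i)) (h : Thm31Printed c35 geo bg Gp) :
    Thm31Printed c35 (fun j => geo (φ j)) (fun j => bg (φ j)) (fun j => Gp (φ j)) := by
  obtain ⟨M₁, δ₀, a₀, B₀, Bβ, Bε, Bεβ, hM₁, hδ₀, ha₀, hB₀, H⟩ := h
  exact ⟨M₁, δ₀, a₀, B₀, Bβ, Bε, Bεβ, hM₁, hδ₀, ha₀, hB₀, fun j => H (φ j)⟩

/-- Theorem 3.2 as typed restricts along a re-indexing. [cite: Balaban1985BackgroundPropagators, Thm 3.2 (3.48) p.398] -/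
theorem thm32Printed_reindex (Cinv : ∀ i, SiteKernel (geo i) (bg i)) (h : Thm32Printed d c35 geo bg Cinv) :
    Thm32Printed d c35 (fun j => geo (φ j)) (fun j => bg (φ j)) (fun j => Cinv (φ j)) := by
  obtain ⟨M₁, δ₀, a₀, B₀, hM₁, hδ₀, ha₀, hB₀, H⟩ := h
  exact ⟨M₁, δ₀, a₀, B₀, hM₁, hδ₀, ha₀, hB₀, fun j => H (φ j)⟩

/-- Theorem 3.3 as typed restricts along a re-indexing. [cite: Balaban1985BackgroundPropagators, Thm 3.3 p.399] -/
theorem thm33Printed_reindex (Gp GA : ∀ i, KernelFamily (geo i) (bg i)) (h : Thm33Printed c35 geo bg Gp GA) :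
    Thm33Printed c35 (fun j => geo (φ j)) (fun j => bg (φ j)) (fun j => Gp (φ j)) (fun j => GA (φ j)) := by
  obtain ⟨M₁, δ₀, a₀, B₀, Bβ, Bε, Bεβ, hM₁, hδ₀, ha₀, hB₀, H⟩ := h
  exact ⟨M₁, δ₀, a₀, B₀, Bβ, Bε, Bεβ, hM₁, hδ₀, ha₀, hB₀, fun j => H (φ j)⟩

end Reindex

variable {d ℓ : ℕ} {hd : 1 ≤ d + 1} {hL : Odd (ℓ + 1) ∧ 1 < ℓ + 1} {b₀ b₁ : ℝ} {Mstar : ℕ}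
variable {𝔸 : Type} [NormedRing 𝔸] (P : RegExtraY d ℓ hd hL b₀ b₁ Mstar 𝔸) [NormedAlgebra ℂ 𝔸] [CompleteSpace 𝔸] (G : Subgroup 𝔸ˣ)
  {J : Type} (f : J → MemberY d ℓ hd hL b₀ b₁ Mstar)
  (C38 : ∀ j : J, ℝ → CfgY 𝔸 (f j).toKIdx → AfldY 𝔸 (f j).toKIdx → Prop)

/-! ## §1 Theorem 3.1 and the `U ≡ 1` block of the record, read over the coded carrier at `(KSCU, KACU, C⁻¹ ∘ dec)` -/

section CodedU

variable (c35 : ℝ) (par : ∀ j : J, SiteParY 𝔸 (f j).toKIdx) (OA : ∀ j : J, BondOpY 𝔸 (f j).toKIdx) (parB : ∀ j : J, BondParY 𝔸 (f j).toKIdx)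
  (C37 : ∀ j : J, ℝ → CfgY 𝔸 (f j).toKIdx → AfldY 𝔸 (f j).toKIdx → Prop)
  (Cinv : ∀ j : J, B9.SiteKernel (geo9Y (f j)) (bg9YC 𝔸 G P (f j)))

/-- ★ Theorem 3.1 of the record for `G′` read by `kernelFamilyS … (GpY par) par` over the class-parametric carrier gives Theorem 3.1 over the coded
carriers for `KSCU`: (3.35)-regular coded configurations are bases, where the U-letter reading IS the record's (`KSCU_members_base`, `rfl`).
[cite: Balaban1985BackgroundPropagators, Thm 3.1 (3.42)–(3.47) pp.397–398, Thm 3.4 p.400, (3.35) p.396] -/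
theorem thm31Printed_codedU
    (h31 : B9.Thm31Printed c35 (fun j => geo9Y (f j)) (fun j => bg9YC 𝔸 G P (f j))
      (fun j => kernelFamilyS (f j).toKIdx (bg9YC 𝔸 G P (f j)) (fun U => U) (GpY (f j).toKIdx (par j)) (par j))) :
    B9.Thm31Printed c35 (fun j => geo9Y (f j)) (fun j => (codingYx P G (f j) (C37 j) (C38 j)).bg) (fun j => KSCU P G (f j) (par j) (C37 j) (C38 j)) := by
  obtain ⟨M₁, δ₀, a₀, B₀, Bβ, Bε, Bεβ, hM₁, hδ₀, ha₀, hB₀, H⟩ :=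
    thm31Printed_coded c35 (fun j => geo9Y (f j)) (fun j => bg9YC 𝔸 G P (f j)) (fun j => codingYx P G (f j) (C37 j) (C38 j)) _ h31
  refine ⟨M₁, δ₀, a₀, B₀, Bβ, Bε, Bεβ, hM₁, hδ₀, ha₀, hB₀, fun j hM α₀ hα₀ hMα c hc => ?_⟩
  obtain ⟨U, rfl, -⟩ := (codingYx P G (f j) (C37 j) (C38 j)).exists_of_bg_Reg335 hc
  obtain ⟨h42, h43⟩ := H j hM α₀ hα₀ hMα _ hc
  obtain ⟨se, sh1, se4, sh2, sl2, sg⟩ := KSCU_members_base P G (f j) (par j) (C37 j) (C38 j) U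
  exact ⟨ineq342_346_347_congr P G (f j) (C37 j) (C38 j) _ _ (fun n => (se n).symm) (fun n => (sl2 n).symm) (fun n => (sg n).symm) B₀ δ₀ h42,
    ineq343_345_congr P G (f j) (C37 j) (C38 j) _ _ sh1.symm se4.symm sh2.symm Bβ Bε Bεβ δ₀ h43⟩

/-- ★ the `U ≡ 1` block of the record (`B9.BaseU1Printed` for `kernelFamilyS … (GpY par) par`, `kernelFamilyB … OA parB`, `C⁻¹`) gives the block over the
coded carriers for `(KSCU, KACU, C⁻¹ ∘ dec)` at `one = base 1` (`thms_KSCU_base_iff`).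
[cite: Balaban1985BackgroundPropagators, Cor. 3.5 proof p.407 («for U = 1 these theorems are proved in [4]»), Thm 3.4 p.400] -/
theorem baseU1Printed_codedU (dC : ℕ)
    (h : B9.BaseU1Printed dC (fun j => geo9Y (f j)) (fun j => bg9YC 𝔸 G P (f j))
      (fun j => kernelFamilyS (f j).toKIdx (bg9YC 𝔸 G P (f j)) (fun U => U) (GpY (f j).toKIdx (par j)) (par j))
      (fun j => kernelFamilyB (f j).toKIdx (bg9YC 𝔸 G P (f j)) (fun U => U) (OA j) (parB j)) Cinv) :
    B9.BaseU1Printed dC (fun j => geo9Y (f j)) (fun j => (codingYx P G (f j) (C37 j) (C38 j)).bg) (fun j => KSCU P G (f j) (par j) (C37 j) (C38 j))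
      (fun j => KACU P G (f j) (OA j) (parB j) (C37 j) (C38 j)) (fun j => pullS (codingYx P G (f j) (C37 j) (C38 j)) (Cinv j)) := by
  obtain ⟨M₁, B₀, δ₀, Bβ, Bε, Bεβ, B₁, δ₁, hM₁, hB₀, hδ₀, hB₁, hδ₁, H⟩ := h
  exact ⟨M₁, B₀, δ₀, Bβ, Bε, Bεβ, B₁, δ₁, hM₁, hB₀, hδ₀, hB₁, hδ₁, fun j hM =>
    (thms_KSCU_base_iff P G (f j) (par j) (OA j) (parB j) (C37 j) (C38 j) dC (Cinv j) B₀ δ₀ Bβ Bε Bεβ B₁ δ₁ _).2 (H j hM)⟩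

end CodedU

/-! ## §2 ★★★ The leaf over the coded carrier -/

section Knit

variable {ι : Type} [Fintype ι] (b : Module.Basis ι ℝ 𝔸) (ιB : ∀ j : J, BlkY (f j).toKIdx → IBondY (f j).toKIdx)
  (ops : ∀ x : MemberY d ℓ hd hL b₀ b₁ Mstar, OperatorLayerY d ℓ hd hL b₀ b₁ Mstar 𝔸 G x)

/-- ★★★ **`B9LeafX (carriersYU P G f b ιB C38 ops)` — THE [B9] LEAF OVER THE CODED CARRIER**, knit fieldwise: `hone` (the class law of `U ≡ 1` at the members),
the `U = 1` comparisons against NODE 00's readings + the two null readings + the residual entries (VERBATIM `b9LeafX_carriersYR`'s), the three PINS (at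
the members `f j` the record's `G′, G, C⁻¹` are NODE 00's letter readings at `parSymY ∕ parBY`), ★ THE CODED SECT.-B STEP `hB : Thm 3.2 → Thm 3.3 → SectBStepU P f …` (U-letters, AS A FUNCTION of the
record's Theorems 3.2 ∕ 3.3 on the subfamily — the shape of dag-n06-c's guarded object at `P := extraYPb`, whose last two inputs they are; the knit derives both
from the rows and feeds them), the record's rows 15–26 at the classes `(regC335 P, regC336 P)` (VERBATIM `b9LeafX_carriersYR`'s
shapes; Thms 3.1 ∕ 3.2 ∕ 3.3 are DERIVED from them at the record — p. 410 — and moved to the coding), and the [B6] block (Props. 2.2 ∕ 2.3 ∕ 2.6 of [4], `U = 1`).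
Cor. 3.6 is vacuous at these carriers (`not_inCubeY`).  No `RWSumsYieldIneqs` over the coded carrier is used.
[cite: Balaban1985BackgroundPropagators, Thms 3.1–3.15 pp.397–432, Thm 3.4 p.400, Cor. 3.5 proof p.407, p.410 («Theorem 3.7 implies … (3.42)–(3.47) hold for G′»); Balaban1984PropagatorsII, Props. 2.2, 2.3, 2.6] -/
theorem b9LeafX_carriersYU (δ₀ : ℝ) {Jt Kt : Type} (tree : Jt → B6.TreeData) (loc : Kt → B6.LocalOp)
    (hone : ∀ (j : J) (α₀ : ℝ), 0 < α₀ → regC335 𝔸 G P (f j) c35Y α₀ (bg9YC 𝔸 G P (f j)).one)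
    (hGp_e : ∀ (x : MemberY d ℓ hd hL b₀ b₁ Mstar) (n : Fin 4) (lam : (geo9Y x).Loc) (y : (geo9Y x).Site),
      (ops x).Gp.e n (bg9Y 𝔸 G x).one lam y ≤ (Node00.GpU x.toKIdx).e n lam y)
    (hGp_h1 : ∀ (x : MemberY d ℓ hd hL b₀ b₁ Mstar) (lam : (geo9Y x).Loc) (b : ℝ) (ζ : (geo9Y x).Cut),
      (ops x).Gp.h1 (bg9Y 𝔸 G x).one lam b ζ ≤ (Node00.GpU x.toKIdx).h1 lam b ζ)
    (hC : ∀ (x : MemberY d ℓ hd hL b₀ b₁ Mstar) (y y' : (geo9Y x).Site), |(ops x).Cinv.ker (bg9Y 𝔸 G x).one y y'| ≤ |(Node00.CinvU x.toKIdx).ker y y'|)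
    (hGA_e : ∀ (x : MemberY d ℓ hd hL b₀ b₁ Mstar) (n : Fin 4) (lam : (geo9Y x).Loc) (y : (geo9Y x).Site),
      (ops x).GA.e n (bg9Y 𝔸 G x).one lam y ≤ (Node00.GU x.toKIdx).e n lam y)
    (hGA_h1 : ∀ (x : MemberY d ℓ hd hL b₀ b₁ Mstar) (lam : (geo9Y x).Loc) (b : ℝ) (ζ : (geo9Y x).Cut),
      (ops x).GA.h1 (bg9Y 𝔸 G x).one lam b ζ ≤ (Node00.GU x.toKIdx).h1 lam b ζ)
    (hGA_e4 : ∀ (x : MemberY d ℓ hd hL b₀ b₁ Mstar) (lam : (geo9Y x).Loc) (y : (geo9Y x).Site),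
      (ops x).GA.e4 (bg9Y 𝔸 G x).one lam y ≤ (Node00.GU x.toKIdx).e4 lam y)
    (hGA_h2 : ∀ (x : MemberY d ℓ hd hL b₀ b₁ Mstar) (lam : (geo9Y x).Loc) (b : ℝ) (ζ : (geo9Y x).Cut),
      (ops x).GA.h2 (bg9Y 𝔸 G x).one lam b ζ ≤ (Node00.GU x.toKIdx).h2 lam b ζ)
    (hGA_l2 : ∀ (x : MemberY d ℓ hd hL b₀ b₁ Mstar) (n : Fin 6) (lam : (geo9Y x).Loc) (h : (geo9Y x).Cut),
      (ops x).GA.l2 n (bg9Y 𝔸 G x).one lam h ≤ (Node00.GU x.toKIdx).l2 n lam h)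
    (hE4 : ∀ (x : MemberY d ℓ hd hL b₀ b₁ Mstar) (lam : (geo9Y x).Loc), ¬ (lam.isRight = true) → ∀ y, (ops x).GA.e4 (bg9Y 𝔸 G x).one lam y ≤ 0)
    (hH2 : ∀ (x : MemberY d ℓ hd hL b₀ b₁ Mstar) (lam : (geo9Y x).Loc), ¬ (lam.isRight = true) →
      ∀ (β : ℝ) (ζ : (geo9Y x).Cut), (ops x).GA.h2 (bg9Y 𝔸 G x).one lam β ζ ≤ 0)
    (hGp : B9FromB6.ResidualGpAtOne geo9Y (bg9YR 𝔸 G (regC335 𝔸 G P) (regC336 𝔸 G P)) (fun x => kernelFamilyR (regC335 𝔸 G P) (regC336 𝔸 G P) (ops x).Gp))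
    (hGA : B9FromB6.ResidualGAGlobAtOne geo9Y (bg9YR 𝔸 G (regC335 𝔸 G P) (regC336 𝔸 G P)) (fun x => kernelFamilyR (regC335 𝔸 G P) (regC336 𝔸 G P) (ops x).GA))
    (hGpPin : ∀ j : J, kernelFamilyR (regC335 𝔸 G P) (regC336 𝔸 G P) (ops (f j)).Gp =
      kernelFamilyS (f j).toKIdx (bg9YC 𝔸 G P (f j)) (fun U => U) (GpY (f j).toKIdx (parSymY (f j).toKIdx)) (parSymY (f j).toKIdx))
    (hGAPin : ∀ j : J, kernelFamilyR (regC335 𝔸 G P) (regC336 𝔸 G P) (ops (f j)).GA =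
      kernelFamilyB (f j).toKIdx (bg9YC 𝔸 G P (f j)) (fun U => U)
        (GAY (f j).toKIdx (parSymY (f j).toKIdx) (parBY (f j).toKIdx) (GpY (f j).toKIdx (parSymY (f j).toKIdx))) (parBY (f j).toKIdx))
    (hCinvPin : ∀ j : J, siteKernelR (regC335 𝔸 G P) (regC336 𝔸 G P) (ops (f j)).Cinv = CinvY P f G (fun j => parSymY (f j).toKIdx) j)
    (hB : B9.Thm32Printed (d + 1) c35Y (fun j => geo9Y (f j)) (fun j => bg9YC 𝔸 G P (f j)) (CinvY P f G (fun j => parSymY (f j).toKIdx)) →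
      B9.Thm33Printed c35Y (fun j => geo9Y (f j)) (fun j => bg9YC 𝔸 G P (f j))
        (fun j => kernelFamilyS (f j).toKIdx (bg9YC 𝔸 G P (f j)) (fun U => U) (GpY (f j).toKIdx (parSymY (f j).toKIdx)) (parSymY (f j).toKIdx))
        (fun j => kernelFamilyB (f j).toKIdx (bg9YC 𝔸 G P (f j)) (fun U => U)
          (GAY (f j).toKIdx (parSymY (f j).toKIdx) (parBY (f j).toKIdx) (GpY (f j).toKIdx (parSymY (f j).toKIdx))) (parBY (f j).toKIdx)) →
      SectBStepU P f (d + 1) c35Y G b (fun j => parSymY (f j).toKIdx)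
        (fun j => GAY (f j).toKIdx (parSymY (f j).toKIdx) (parBY (f j).toKIdx) (GpY (f j).toKIdx (parSymY (f j).toKIdx))) (fun j => parBY (f j).toKIdx)
        (fun j => C37GY G (f j) (ιB j) (cqY d)) C38 (CinvY P f G (fun j => parSymY (f j).toKIdx)))
    (t37 : B9.Thm37Printed c35Y geo9Y (bg9YR 𝔸 G (regC335 𝔸 G P) (regC336 𝔸 G P)) (fun x => rwExpansionR (regC335 𝔸 G P) (regC336 𝔸 G P) (ops x).E37))
    (c38 : B9.Cor38Printed c35Y geo9Y (bg9YR 𝔸 G (regC335 𝔸 G P) (regC336 𝔸 G P)) (fun x => rwExpansionR (regC335 𝔸 G P) (regC336 𝔸 G P) (ops x).E37))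
    (t39 : B9.Thm39Printed (d + 1) c35Y geo9Y (bg9YR 𝔸 G (regC335 𝔸 G P) (regC336 𝔸 G P))
      (fun x => rwKernelExpansionR (regC335 𝔸 G P) (regC336 𝔸 G P) (ops x).EK39))
    (t310 : B9.Thm310Printed c35Y geo9Y (bg9YR 𝔸 G (regC335 𝔸 G P) (regC336 𝔸 G P)) (fun x => rwExpansionR (regC335 𝔸 G P) (regC336 𝔸 G P) (ops x).E310))
    (hsum : B9.RWSumsYieldIneqs geo9Y (bg9YR 𝔸 G (regC335 𝔸 G P) (regC336 𝔸 G P)) (fun x => rwExpansionR (regC335 𝔸 G P) (regC336 𝔸 G P) (ops x).E37)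
      (fun x => rwExpansionR (regC335 𝔸 G P) (regC336 𝔸 G P) (ops x).E310) (fun x => kernelFamilyR (regC335 𝔸 G P) (regC336 𝔸 G P) (ops x).Gp)
      (fun x => kernelFamilyR (regC335 𝔸 G P) (regC336 𝔸 G P) (ops x).GA))
    (hksum : B9.RWKernelSumYields (d + 1) geo9Y (bg9YR 𝔸 G (regC335 𝔸 G P) (regC336 𝔸 G P))
      (fun x => rwKernelExpansionR (regC335 𝔸 G P) (regC336 𝔸 G P) (ops x).EK39) (fun x => siteKernelR (regC335 𝔸 G P) (regC336 𝔸 G P) (ops x).Cinv))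
    (t311 : B9.Thm311Printed c35Y geo9Y (bg9YR 𝔸 G (regC335 𝔸 G P) (regC336 𝔸 G P)) (fun x => (ops x).PosDef))
    (t312 : B9.Thm312Printed (d + 1) c35Y geo9Y (bg9YR 𝔸 G (regC335 𝔸 G P) (regC336 𝔸 G P))
      (fun x => kernelFamilyR (regC335 𝔸 G P) (regC336 𝔸 G P) (ops x).GD) (fun x => kernelFamilyR (regC335 𝔸 G P) (regC336 𝔸 G P) (ops x).G₁)
      (fun x => hKernelR (regC335 𝔸 G P) (regC336 𝔸 G P) (ops x).H) (fun x => hKernelR (regC335 𝔸 G P) (regC336 𝔸 G P) (ops x).H₁)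
      (fun x K => (ops x).HasRWExp (kernelFamilyRY K)) (fun x K => (ops x).HasRWExpH (hKernelRY K)) (fun x K => (ops x).PosDefK (kernelFamilyRY K)))
    (t313 : B9.Thm313Printed c35Y geo9Y (bg9YR 𝔸 G (regC335 𝔸 G P) (regC336 𝔸 G P)) (fun x => kernelFamilyR (regC335 𝔸 G P) (regC336 𝔸 G P) (ops x).GG)
      (fun x K => (ops x).HasRWExp (kernelFamilyRY K)) (fun x K => (ops x).PosDefK (kernelFamilyRY K)))
    (t314 : B9.Thm314Printed c35Y geo9Y (bg9YR 𝔸 G (regC335 𝔸 G P) (regC336 𝔸 G P)) (fun x => kernelFamilyR (regC335 𝔸 G P) (regC336 𝔸 G P) (ops x).Kdiff)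
      dOmegaY)
    (t315 : B9.Thm315FullPrinted c35Y geo9Y (bg9YR 𝔸 G (regC335 𝔸 G P) (regC336 𝔸 G P)) (fun x => siteKernelR (regC335 𝔸 G P) (regC336 𝔸 G P) (ops x).Ck)
      inΛY unitDistY (fun x => (ops x).GivenBy3185) (fun x => (ops x).HasRWExpC))
    (s349 : B9.Stmt349Printed (d + 1) c35Y geo9Y (bg9YR 𝔸 G (regC335 𝔸 G P) (regC336 𝔸 G P))
      (fun x => fineKernelR (regC335 𝔸 G P) (regC336 𝔸 G P) (ops x).P349))
    (s3132 : B9.Stmt3132Printed (d + 1) c35Y geo9Y (bg9YR 𝔸 G (regC335 𝔸 G P) (regC336 𝔸 G P))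
      (fun x => siteKernelR (regC335 𝔸 G P) (regC336 𝔸 G P) (ops x).QGQinv) (fun x => siteKernelR (regC335 𝔸 G P) (regC336 𝔸 G P) (ops x).QG1Qinv))
    (t314loc : B9Thm314.Thm314LocalPrinted c35Y geo9Y (bg9YR 𝔸 G (regC335 𝔸 G P) (regC336 𝔸 G P))
      (fun x => kernelFamilyR (regC335 𝔸 G P) (regC336 𝔸 G P) (ops x).Kdiff) OmKY dOmegaY)
    (h6 : B6BlockParam (Node00.towerBlockOfRecord d ℓ hd hL b₀ b₁ δ₀ tree loc)) :
    B9LeafX (carriersYU P G f b ιB C38 ops) := by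
  -- (1) at the record, over the full member family at the classes `(regC335 P, regC336 P)`: the `U ≡ 1` block from [B6], Thms 3.1 ∕ 3.2 ∕ 3.3 from rows 15–19
  have hbaseR : B9.BaseU1Printed (d + 1) geo9Y (bg9YR 𝔸 G (regC335 𝔸 G P) (regC336 𝔸 G P))
      (fun x => kernelFamilyR (regC335 𝔸 G P) (regC336 𝔸 G P) (ops x).Gp) (fun x => kernelFamilyR (regC335 𝔸 G P) (regC336 𝔸 G P) (ops x).GA)
      (fun x => siteKernelR (regC335 𝔸 G P) (regC336 𝔸 G P) (ops x).Cinv) :=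
    baseU1_of_b6BlockParam_on (carriersYR d ℓ hd hL b₀ b₁ Mstar 𝔸 G (regC335 𝔸 G P) (regC336 𝔸 G P) ops).toPrintedCarriers9
      (Node00.towerBlockOfRecord d ℓ hd hL b₀ b₁ δ₀ tree loc) rfl (fun x => ⟨x.toKIdx, x.hcfk⟩)
      (fun x => dictAtOneY x (kernelFamilyR (regC335 𝔸 G P) (regC336 𝔸 G P) (ops x).Gp) (kernelFamilyR (regC335 𝔸 G P) (regC336 𝔸 G P) (ops x).GA)
        (siteKernelR (regC335 𝔸 G P) (regC336 𝔸 G P) (ops x).Cinv) (hGp_e x) (hGp_h1 x) (hC x) (hGA_e x) (hGA_h1 x) (hGA_e4 x) (hGA_h2 x) (hGA_l2 x))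
      (fun _ => fun lam => lam.isRight = true) (fun x => B9GeoNormsKLevelModelSignsV1.modelSignsOn_geo9K x.toKIdx) hE4 hH2 hGp hGA h6
  have h31R := B9.thm31_of_thm37 c35Y geo9Y (bg9YR 𝔸 G (regC335 𝔸 G P) (regC336 𝔸 G P)) _ _ _ _ t37 hsum
  have h32R := B9.thm32_of_thm39 (d + 1) c35Y geo9Y (bg9YR 𝔸 G (regC335 𝔸 G P) (regC336 𝔸 G P)) _ _ t39 hksum
  have h33R := B9.thm33_of_thm37_310 c35Y geo9Y (bg9YR 𝔸 G (regC335 𝔸 G P) (regC336 𝔸 G P)) _ _ _ _ t37 t310 hsum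
  -- (2) along the subfamily, re-keyed to NODE 00's letter readings by the pins
  have eGp := funext hGpPin
  have eGA := funext hGAPin
  have eC := funext hCinvPin
  have hbaseJ := baseU1Printed_reindex f (d + 1) geo9Y (bg9YR 𝔸 G (regC335 𝔸 G P) (regC336 𝔸 G P)) _ _ _ hbaseR
  have h31J := thm31Printed_reindex f c35Y geo9Y (bg9YR 𝔸 G (regC335 𝔸 G P) (regC336 𝔸 G P)) _ h31R
  have h32J := thm32Printed_reindex f (d + 1) c35Y geo9Y (bg9YR 𝔸 G (regC335 𝔸 G P) (regC336 𝔸 G P)) _ h32R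
  have h33J := thm33Printed_reindex f c35Y geo9Y (bg9YR 𝔸 G (regC335 𝔸 G P) (regC336 𝔸 G P)) _ _ h33R
  rw [eGp, eGA, eC] at hbaseJ
  rw [eGp] at h31J
  rw [eC] at h32J
  rw [eGp, eGA] at h33J
  have h32J' : B9.Thm32Printed (d + 1) c35Y (fun j => geo9Y (f j)) (fun j => bg9YC 𝔸 G P (f j)) (CinvY P f G (fun j => parSymY (f j).toKIdx)) := h32J
  have h33J' : B9.Thm33Printed c35Y (fun j => geo9Y (f j)) (fun j => bg9YC 𝔸 G P (f j))
      (fun j => kernelFamilyS (f j).toKIdx (bg9YC 𝔸 G P (f j)) (fun U => U) (GpY (f j).toKIdx (parSymY (f j).toKIdx)) (parSymY (f j).toKIdx))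
      (fun j => kernelFamilyB (f j).toKIdx (bg9YC 𝔸 G P (f j)) (fun U => U)
        (GAY (f j).toKIdx (parSymY (f j).toKIdx) (parBY (f j).toKIdx) (GpY (f j).toKIdx (parSymY (f j).toKIdx))) (parBY (f j).toKIdx)) := h33J
  have hBU := hB h32J' h33J'
  -- (3) over the coded carrier
  have hbaseU := baseU1Printed_codedU P G f C38 (fun j => parSymY (f j).toKIdx)
    (fun j => GAY (f j).toKIdx (parSymY (f j).toKIdx) (parBY (f j).toKIdx) (GpY (f j).toKIdx (parSymY (f j).toKIdx))) (fun j => parBY (f j).toKIdx)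
    (fun j => C37GY G (f j) (ιB j) (cqY d)) (CinvY P f G (fun j => parSymY (f j).toKIdx)) (d + 1) hbaseJ
  have h31U := thm31Printed_codedU P G f C38 c35Y (fun j => parSymY (f j).toKIdx) (fun j => C37GY G (f j) (ιB j) (cqY d)) h31J
  have h32U := thm32Printed_codedU P f c35Y G C38 (C37 := fun j => C37GY G (f j) (ιB j) (cqY d))
    (Cinv := CinvY P f G (fun j => parSymY (f j).toKIdx)) (d + 1) h32J
  have h33U := thm33Printed_codedU P f c35Y G C38 (fun j => parSymY (f j).toKIdx)
    (fun j => GAY (f j).toKIdx (parSymY (f j).toKIdx) (parBY (f j).toKIdx) (GpY (f j).toKIdx (parSymY (f j).toKIdx))) (fun j => parBY (f j).toKIdx)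
    (fun j => C37GY G (f j) (ιB j) (cqY d)) h33J
  have honeU : ∀ (j : J) (α₀ : ℝ), 0 < α₀ → ((carriersYU P G f b ιB C38 ops).bg9 j).Reg335 c35Y α₀ ((carriersYU P G f b ιB C38 ops).bg9 j).one :=
    fun j α₀ hα => hone j α₀ hα
  have h35 := B9.cor35_of_sectB_base (d + 1) c35Y (carriersYU P G f b ιB C38 ops).geo9 (carriersYU P G f b ιB C38 ops).bg9
    (carriersYU P G f b ιB C38 ops).Gp (carriersYU P G f b ιB C38 ops).GA (carriersYU P G f b ιB C38 ops).Cinv (carriersYU P G f b ιB C38 ops).IsAnalyticExt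
    honeU hbaseU hBU
  have hg : B9.GaugeReduction335 (d + 1) c35Y (carriersYU P G f b ιB C38 ops).geo9 (carriersYU P G f b ιB C38 ops).bg9 (carriersYU P G f b ιB C38 ops).InCube
      (carriersYU P G f b ιB C38 ops).Gp (carriersYU P G f b ιB C38 ops).GA (carriersYU P G f b ιB C38 ops).Cinv :=
    fun j hj => absurd hj (not_inCubeY (f j))
  have h36 := B9.cor36_of_cor35 (d + 1) c35Y c35Y_pos _ _ _ _ _ _ h35 hg
  have h34 := B9.thm34_of_sectB (d + 1) c35Y (carriersYU P G f b ιB C38 ops).geo9 (carriersYU P G f b ιB C38 ops).bg9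
    (carriersYU P G f b ιB C38 ops).Gp (carriersYU P G f b ιB C38 ops).GA (carriersYU P G f b ιB C38 ops).Cinv (carriersYU P G f b ιB C38 ops).IsAnalyticExt
    hBU h32U h33U
  exact ⟨⟨h35, h36, h31U, h32U, h33U, h34,
      thm37Printed_coded c35Y _ _ (fun j => codingYU P G f ιB C38 j) _ (thm37Printed_reindex f c35Y geo9Y _ _ t37),
      cor38Printed_coded c35Y _ _ (fun j => codingYU P G f ιB C38 j) _ (cor38Printed_reindex f c35Y geo9Y _ _ c38),
      thm39Printed_coded (d + 1) c35Y _ _ (fun j => codingYU P G f ιB C38 j) _ (thm39Printed_reindex f (d + 1) c35Y geo9Y _ _ t39),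
      thm310Printed_coded c35Y _ _ (fun j => codingYU P G f ιB C38 j) _ (thm310Printed_reindex f c35Y geo9Y _ _ t310),
      thm311Printed_coded c35Y _ _ (fun j => codingYU P G f ιB C38 j) _ (thm311Printed_reindex f c35Y geo9Y _ _ t311),
      thm312Printed_coded (d + 1) c35Y _ _ (fun j => codingYU P G f ιB C38 j) _ _ _ _ _ _ _ (thm312Printed_reindex f (d + 1) c35Y geo9Y _ _ _ _ _ _ _ _ t312),
      thm313Printed_coded c35Y _ _ (fun j => codingYU P G f ιB C38 j) _ _ _ (thm313Printed_reindex f c35Y geo9Y _ _ _ _ t313),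
      thm314Printed_coded c35Y _ _ (fun j => codingYU P G f ιB C38 j) _ _ (thm314Printed_reindex f c35Y geo9Y _ _ _ t314),
      thm315FullPrinted_coded c35Y _ _ (fun j => codingYU P G f ιB C38 j) _ _ _ _ _ (thm315FullPrinted_reindex f c35Y geo9Y _ _ _ _ _ _ t315)⟩,
    stmt349Printed_coded (d + 1) c35Y _ _ (fun j => codingYU P G f ιB C38 j) _ (stmt349Printed_reindex f (d + 1) c35Y geo9Y _ _ s349),
    stmt3132Printed_coded (d + 1) c35Y _ _ (fun j => codingYU P G f ιB C38 j) _ _ (stmt3132Printed_reindex f (d + 1) c35Y geo9Y _ _ _ s3132),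
    thm314LocalPrinted_coded c35Y _ _ (fun j => codingYU P G f ιB C38 j) _ _ _ (thm314LocalPrinted_reindex f c35Y geo9Y _ _ _ _ t314loc)⟩

end Knit

end Literature.MathematicalPhysics.QuantumFieldTheory.Balaban1983to89.B9LeafXCodedKnitU

end
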